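import Mathlib

/-!
# The zero-momentum imprint: law-free energy skeleton (kernel K20)

Solo seat `solo-AtomisticToContinuum-blind`, conjunct `BoseEinsteinCondensation`; paper §11.6
(No-go F″: exact zero total momentum does not price fragmentation beyond `N(2π/L)²`).

On the torus the trial state `Φ_A = J₀(A|ρ̂_k|)Ψ₀`, `ρ̂_k = Σ_j e^{ik·x_j}`, is the exact
zero-momentum component of a phase-imprinted ground state, and its excess energy obeys the
LAW-FREE bound `E(Φ_A) − E₀ ≤ 4c₂A₀²·N k_L²` for some `A ∈ [A₀,2A₀]`.  This file checks the
finite-dimensional skeleton of that bound: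

1. `sum_sq_sum_sin_sub_le` — the collective-phase inequality
   `Σ_j (Σ_l sin(θ_j − θ_l))² ≤ N·|Σ_l e^{iθ_l}|²` (from `Σ_l sin(θ_j−θ_l) = Im(e^{iθ_j}·conj ρ̂)`,
   `sum_sin_sub_eq_im`), which is `Σ_j |∇_j J₀(A|ρ̂_k|)|² ≤ A²N k_L² J₁(A|ρ̂_k|)²` once the
   one-coordinate derivative `hasDerivAt_normSq_add_exp` (`d/dt |c + e^{it}|² = −2 Im(e^{it} conj c)`)
   and the chain rule are inserted (`deriv_sq_le`: `(d/dt G(|c+e^{it}|²))² ≤ 4 g² |c+e^{it}|²`;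
   all coordinates at once: `sum_sq_partialDeriv_le`, `Σ_j (∂_{θ_j} G(|ρ̂|²))² ≤ 4 g² N |ρ̂|²`);
2. `exists_mem_Icc_le_of_integral_le` — the window pigeonhole: `∫_a^b f ≤ c∫_a^b g`, `f,g`
   continuous ⇒ `∃ A ∈ [a,b], f A ≤ c·g A`;
3. `window_scaling` — the law-free step: a Bessel-window hypothesis
   `∀ t₀>0, ∫_{t₀}^{2t₀} j₁² ≤ c₂ ∫_{t₀}^{2t₀} j₀²` transports to EVERY dilation `u ≥ 0`:
   `∫_{A₀}^{2A₀} j₁(Au)² dA ≤ c₂ ∫_{A₀}^{2A₀} j₀(Au)² dA` — no information on the law of `u` is used;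
4. `exists_window_ratio_le` — for any finitely supported law `Σ_i p_i δ_{u_i}` of the collective
   variable: `∃ A ∈ [A₀,2A₀]` with `A²·(Σ_i p_i j₁(Au_i)²) ≤ 4c₂A₀²·(Σ_i p_i j₀(Au_i)²)`;
5. `discrete_groundState_repr` — the ground-state representation on a weighted graph:
   if `(−W + U)ψ = Eψ` then `⟨Fψ, (−W + U − E)(Fψ)⟩ = ½ Σ_{x,y} w_{xy} ψ_x ψ_y (F_x − F_y)²`.

Items 2–5 with `j₀ = J₀`, `j₁ = J₁`, `c₂ = 4.551…` (numerical) and the continuum version of 5 give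
Proposition 11.6(a).  Bessel functions are not used here: `j₀, j₁` are arbitrary continuous functions.
-/

noncomputable section

open MeasureTheory Filter Set Finset intervalIntegral
open scoped Real ComplexConjugate BigOperators

namespace Summit.AtomisticToContinuum.BoseEinsteinCondensation.Theorems

/-! ## 1. The collective phase variable -/

-- Throughout, `ρ̂ = ∑ l ∈ s, exp(i θ_l)` is the density Fourier mode `ρ̂_k` in phase variables
-- (written out in full: no definition or notation is introduced).

/-- `Σ_l sin(θ_j − θ_l) = Im(e^{iθ_j} · conj ρ̂)`. -/
lemma sum_sin_sub_eq_im {ι : Type*} (s : Finset ι) (θ : ι → ℝ) (j : ι) :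
    ∑ l ∈ s, Real.sin (θ j - θ l) =
      (Complex.exp (θ j * Complex.I) * conj ((∑ l ∈ s, Complex.exp ((θ l : ℂ) * Complex.I)))).im := by
  rw [map_sum, Finset.mul_sum, Complex.im_sum]
  refine Finset.sum_congr rfl fun l _ => ?_
  rw [← Complex.exp_conj, map_mul, Complex.conj_ofReal, Complex.conj_I, mul_neg,
    ← Complex.exp_add]
  have : (θ j : ℂ) * Complex.I + -((θ l : ℂ) * Complex.I) = ((θ j - θ l : ℝ) : ℂ) * Complex.I := by
    push_cast; ring
  rw [this, Complex.exp_ofReal_mul_I_im]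

/-- `|e^{ix}|² = 1`. -/
lemma normSq_exp_mul_I (x : ℝ) : Complex.normSq (Complex.exp (x * Complex.I)) = 1 := by
  rw [Complex.normSq_eq_norm_sq, Complex.norm_exp_ofReal_mul_I, one_pow]

/-- The collective-phase inequality: `Σ_j (Σ_l sin(θ_j − θ_l))² ≤ #s · |Σ_l e^{iθ_l}|²`. -/
theorem sum_sq_sum_sin_sub_le {ι : Type*} (s : Finset ι) (θ : ι → ℝ) :
    ∑ j ∈ s, (∑ l ∈ s, Real.sin (θ j - θ l)) ^ 2 ≤
      s.card * Complex.normSq ((∑ l ∈ s, Complex.exp ((θ l : ℂ) * Complex.I))) := by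
  have h : ∀ j ∈ s, (∑ l ∈ s, Real.sin (θ j - θ l)) ^ 2 ≤
      Complex.normSq ((∑ l ∈ s, Complex.exp ((θ l : ℂ) * Complex.I))) := by
    intro j _
    rw [sum_sin_sub_eq_im]
    have him : ∀ z : ℂ, z.im ^ 2 ≤ Complex.normSq z := fun z => by
      rw [Complex.normSq_apply]; nlinarith [sq_nonneg z.re]
    refine (him _).trans ?_
    rw [Complex.normSq_mul, Complex.normSq_conj, normSq_exp_mul_I, one_mul]
  calc ∑ j ∈ s, (∑ l ∈ s, Real.sin (θ j - θ l)) ^ 2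
      ≤ ∑ j ∈ s, Complex.normSq ((∑ l ∈ s, Complex.exp ((θ l : ℂ) * Complex.I))) := Finset.sum_le_sum h
    _ = s.card * Complex.normSq ((∑ l ∈ s, Complex.exp ((θ l : ℂ) * Complex.I))) := by
      rw [Finset.sum_const, nsmul_eq_mul]

/-! ## 2. One-coordinate derivative of `|ρ̂|²` and the chain-rule bound -/

/-- `d/dt |c + e^{it}|² = −2 Im(e^{it} · conj c)`. -/
theorem hasDerivAt_normSq_add_exp (c : ℂ) (t : ℝ) :
    HasDerivAt (fun s : ℝ => Complex.normSq (c + Complex.exp (s * Complex.I)))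
      (-2 * (Complex.exp (t * Complex.I) * conj c).im) t := by
  have hfun : (fun s : ℝ => Complex.normSq (c + Complex.exp (s * Complex.I))) =
      fun s => (c.re + Real.cos s) * (c.re + Real.cos s) + (c.im + Real.sin s) * (c.im + Real.sin s) := by
    funext s
    rw [Complex.normSq_apply, Complex.add_re, Complex.add_im, Complex.exp_ofReal_mul_I_re,
      Complex.exp_ofReal_mul_I_im]
  rw [hfun]
  have hval : -2 * (Complex.exp (t * Complex.I) * conj c).im =
      (-Real.sin t * (c.re + Real.cos t) + (c.re + Real.cos t) * -Real.sin t) +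
        (Real.cos t * (c.im + Real.sin t) + (c.im + Real.sin t) * Real.cos t) := by
    rw [Complex.mul_im, Complex.exp_ofReal_mul_I_re, Complex.exp_ofReal_mul_I_im,
      Complex.conj_re, Complex.conj_im]
    ring
  rw [hval]
  have hc' : HasDerivAt (fun s : ℝ => c.re + Real.cos s) (-Real.sin t) t :=
    (Real.hasDerivAt_cos t).const_add c.re
  have hs' : HasDerivAt (fun s : ℝ => c.im + Real.sin s) (Real.cos t) t :=
    (Real.hasDerivAt_sin t).const_add c.im
  exact (hc'.mul hc').add (hs'.mul hs')

/-- `Im(e^{it} conj c) = Im(e^{it} conj(c + e^{it}))`: the phase of particle `j` may be included in `ρ̂`. -/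
lemma im_exp_mul_conj_add (c : ℂ) (t : ℝ) :
    (Complex.exp (t * Complex.I) * conj (c + Complex.exp (t * Complex.I))).im =
      (Complex.exp (t * Complex.I) * conj c).im := by
  rw [map_add, mul_add, Complex.add_im, Complex.mul_conj, Complex.normSq_eq_norm_sq,
    Complex.norm_exp_ofReal_mul_I]
  simp

/-- Chain rule + the bound: for `F(t) = G(|c + e^{it}|²)` with `G' = g` at the point,
`F'(t)² ≤ 4 g² |c + e^{it}|²`.  (With `θ_j = k_L x_j` this is `|∂_{x_j}F|² ≤ 4k_L² g² u²·sin²`, summed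
over `j` by `sum_sq_sum_sin_sub_le`.) -/
theorem deriv_sq_le (G : ℝ → ℝ) (g : ℝ) (c : ℂ) (t : ℝ)
    (hG : HasDerivAt G g (Complex.normSq (c + Complex.exp (t * Complex.I)))) :
    HasDerivAt (fun s : ℝ => G (Complex.normSq (c + Complex.exp (s * Complex.I))))
        (g * (-2 * (Complex.exp (t * Complex.I) * conj c).im)) t ∧
      (g * (-2 * (Complex.exp (t * Complex.I) * conj c).im)) ^ 2 ≤
        4 * g ^ 2 * Complex.normSq (c + Complex.exp (t * Complex.I)) := by
  refine ⟨hG.comp t (hasDerivAt_normSq_add_exp c t), ?_⟩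
  have him : ∀ z : ℂ, z.im ^ 2 ≤ Complex.normSq z := fun z => by
    rw [Complex.normSq_apply]; nlinarith [sq_nonneg z.re]
  have h := him (Complex.exp (t * Complex.I) * conj (c + Complex.exp (t * Complex.I)))
  rw [im_exp_mul_conj_add, Complex.normSq_mul, Complex.normSq_conj, normSq_exp_mul_I, one_mul] at h
  nlinarith [sq_nonneg g, h]

/-! ## 2b. All coordinates: `Σ_j |∂_j G(|ρ̂|²)|² ≤ 4 g² N |ρ̂|²` -/

/-- Varying one phase: `ρ̂(θ with θ_j := t) = ρ̂'_j + e^{it}`. -/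
lemma collectivePhase_update {ι : Type*} [DecidableEq ι] (s : Finset ι) (θ : ι → ℝ) {j : ι}
    (hj : j ∈ s) (t : ℝ) :
    (∑ l ∈ s, Complex.exp ((Function.update θ j t l : ℂ) * Complex.I)) =
      (∑ l ∈ s.erase j, Complex.exp ((θ l : ℂ) * Complex.I)) + Complex.exp (t * Complex.I) := by
  rw [← Finset.add_sum_erase s _ hj, Function.update_self, add_comm]
  congr 1
  exact Finset.sum_congr rfl fun l hl => by rw [Function.update_of_ne (Finset.ne_of_mem_erase hl)]

/-- Lemma 11.6A in phase variables: varying the `j`-th phase alone, `F = G(|ρ̂|²)` has derivative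
`g·(−2 Im(e^{iθ_j} conj ρ̂'_j))` (`ρ̂'_j` = the other particles' amplitude), and the sum of the squares
of these partial derivatives is at most `4 g² · N · |ρ̂|²` — for `G(s) = J₀(A√s)` this is
`A² N J₁(A|ρ̂|)²`; with `θ_j = k_L x_j` a factor `k_L²` appears. -/
theorem sum_sq_partialDeriv_le {ι : Type*} [DecidableEq ι] (s : Finset ι) (θ : ι → ℝ)
    (G : ℝ → ℝ) (g : ℝ) (hG : HasDerivAt G g (Complex.normSq ((∑ l ∈ s, Complex.exp ((θ l : ℂ) * Complex.I))))) :
    (∀ j ∈ s, HasDerivAt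
        (fun t : ℝ => G (Complex.normSq ((∑ l ∈ s, Complex.exp ((Function.update θ j t l : ℂ) * Complex.I)))))
        (g * (-2 * (Complex.exp (θ j * Complex.I) *
          conj ((∑ l ∈ s.erase j, Complex.exp ((θ l : ℂ) * Complex.I)))).im)) (θ j)) ∧
    ∑ j ∈ s, (g * (-2 * (Complex.exp (θ j * Complex.I) *
        conj ((∑ l ∈ s.erase j, Complex.exp ((θ l : ℂ) * Complex.I)))).im)) ^ 2 ≤
      4 * g ^ 2 * (s.card * Complex.normSq ((∑ l ∈ s, Complex.exp ((θ l : ℂ) * Complex.I)))) := by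
  have hsplit : ∀ j ∈ s, (∑ l ∈ s.erase j, Complex.exp ((θ l : ℂ) * Complex.I)) + Complex.exp (θ j * Complex.I) =
      (∑ l ∈ s, Complex.exp ((θ l : ℂ) * Complex.I)) := by
    intro j hj
    have h := collectivePhase_update s θ hj (θ j)
    rw [Function.update_eq_self] at h
    exact h.symm
  constructor
  · intro j hj
    have hfun : (fun t : ℝ => G (Complex.normSq ((∑ l ∈ s, Complex.exp ((Function.update θ j t l : ℂ) * Complex.I))))) =
        fun t : ℝ => G (Complex.normSq ((∑ l ∈ s.erase j, Complex.exp ((θ l : ℂ) * Complex.I)) +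
          Complex.exp ((t : ℂ) * Complex.I))) := by
      funext t; rw [collectivePhase_update s θ hj t]
    rw [hfun]
    have hG' : HasDerivAt G g (Complex.normSq ((∑ l ∈ s.erase j, Complex.exp ((θ l : ℂ) * Complex.I)) +
        Complex.exp (θ j * Complex.I))) := by
      rw [hsplit j hj]; exact hG
    exact (deriv_sq_le G g _ (θ j) hG').1
  · have hpt : ∀ j ∈ s, (g * (-2 * (Complex.exp (θ j * Complex.I) *
        conj ((∑ l ∈ s.erase j, Complex.exp ((θ l : ℂ) * Complex.I)))).im)) ^ 2 =
          4 * g ^ 2 * (∑ l ∈ s, Real.sin (θ j - θ l)) ^ 2 := by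
      intro j hj
      rw [sum_sin_sub_eq_im, ← hsplit j hj, im_exp_mul_conj_add]
      ring
    rw [Finset.sum_congr rfl hpt, ← Finset.mul_sum]
    exact mul_le_mul_of_nonneg_left (sum_sq_sum_sin_sub_le s θ) (by positivity)

/-! ## 3. Window pigeonhole -/

/-- If `∫_a^b f ≤ c ∫_a^b g` for continuous `f, g` on `[a,b]`, `a < b`, then `f A ≤ c·g A` somewhere. -/
theorem exists_mem_Icc_le_of_integral_le {f g : ℝ → ℝ} {a b c : ℝ} (hab : a < b)
    (hf : ContinuousOn f (Icc a b)) (hg : ContinuousOn g (Icc a b))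
    (h : ∫ x in a..b, f x ≤ c * ∫ x in a..b, g x) :
    ∃ A ∈ Icc a b, f A ≤ c * g A := by
  by_contra! hcon
  have hfi : IntervalIntegrable f volume a b :=
    (hf.mono (by rw [Set.uIcc_of_le hab.le])).intervalIntegrable
  have hgi : IntervalIntegrable g volume a b :=
    (hg.mono (by rw [Set.uIcc_of_le hab.le])).intervalIntegrable
  have hpos : 0 < ∫ x in a..b, (f x - c * g x) := by
    refine intervalIntegral.intervalIntegral_pos_of_pos_on (hfi.sub (hgi.const_mul c)) ?_ hab
    intro x hx
    exact sub_pos.mpr (hcon x (Ioo_subset_Icc_self hx))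
  rw [intervalIntegral.integral_sub hfi (hgi.const_mul c), intervalIntegral.integral_const_mul] at hpos
  linarith

/-! ## 4. The law-free scaling step -/

/-- A window inequality for `t₀ ↦ [t₀, 2t₀]` transports to every dilation `u > 0`. -/
theorem window_scaling {j₀ j₁ : ℝ → ℝ} {c₂ : ℝ}
    (hc : ∀ t₀ : ℝ, 0 < t₀ → ∫ t in t₀..2 * t₀, j₁ t ^ 2 ≤ c₂ * ∫ t in t₀..2 * t₀, j₀ t ^ 2)
    {A₀ u : ℝ} (hA : 0 < A₀) (hu : 0 < u) :
    ∫ A in A₀..2 * A₀, j₁ (A * u) ^ 2 ≤ c₂ * ∫ A in A₀..2 * A₀, j₀ (A * u) ^ 2 := by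
  have h1 : ∫ A in A₀..2 * A₀, j₁ (A * u) ^ 2 = u⁻¹ * ∫ t in A₀ * u..2 * A₀ * u, j₁ t ^ 2 := by
    rw [← smul_eq_mul]
    exact intervalIntegral.integral_comp_mul_right (fun t => j₁ t ^ 2) hu.ne'
  have h0 : ∫ A in A₀..2 * A₀, j₀ (A * u) ^ 2 = u⁻¹ * ∫ t in A₀ * u..2 * A₀ * u, j₀ t ^ 2 := by
    rw [← smul_eq_mul]
    exact intervalIntegral.integral_comp_mul_right (fun t => j₀ t ^ 2) hu.ne'
  have key := hc (A₀ * u) (mul_pos hA hu)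
  rw [show 2 * (A₀ * u) = 2 * A₀ * u by ring] at key
  rw [h1, h0, mul_left_comm c₂ u⁻¹]
  exact mul_le_mul_of_nonneg_left key (inv_nonneg.mpr hu.le)

/-- The dilation `u = 0` (collective variable vanishing) is harmless when `j₁ 0 = 0` and `c₂ ≥ 0`. -/
theorem window_scaling_zero {j₀ j₁ : ℝ → ℝ} {c₂ : ℝ} (hc₂ : 0 ≤ c₂) (hj : j₁ 0 = 0)
    {A₀ : ℝ} (hA : 0 < A₀) :
    ∫ A in A₀..2 * A₀, j₁ (A * 0) ^ 2 ≤ c₂ * ∫ A in A₀..2 * A₀, j₀ (A * 0) ^ 2 := by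
  simp only [mul_zero, hj, ne_eq, OfNat.ofNat_ne_zero, not_false_eq_true, zero_pow,
    intervalIntegral.integral_zero]
  refine mul_nonneg hc₂ ?_
  rw [intervalIntegral.integral_const]
  exact smul_nonneg (by linarith) (sq_nonneg _)

/-- Both cases. -/
theorem window_scaling' {j₀ j₁ : ℝ → ℝ} {c₂ : ℝ} (hc₂ : 0 ≤ c₂) (hj : j₁ 0 = 0)
    (hc : ∀ t₀ : ℝ, 0 < t₀ → ∫ t in t₀..2 * t₀, j₁ t ^ 2 ≤ c₂ * ∫ t in t₀..2 * t₀, j₀ t ^ 2)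
    {A₀ u : ℝ} (hA : 0 < A₀) (hu : 0 ≤ u) :
    ∫ A in A₀..2 * A₀, j₁ (A * u) ^ 2 ≤ c₂ * ∫ A in A₀..2 * A₀, j₀ (A * u) ^ 2 := by
  rcases hu.eq_or_lt with h | h
  · rw [← h]; exact window_scaling_zero hc₂ hj hA
  · exact window_scaling hc hA h

/-! ## 5. Finitely supported laws: the window bound for the energy quotient -/

/-- For a finitely supported law `Σ_i p_i δ_{u_i}` (`p_i ≥ 0`, `u_i ≥ 0`) of the collective variable and
continuous `j₀, j₁` with the Bessel-window hypothesis, some `A ∈ [A₀, 2A₀]` has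
`A²·Σ_i p_i j₁(Au_i)² ≤ 4c₂A₀²·Σ_i p_i j₀(Au_i)²`.  With `j₀ = J₀`, `j₁ = J₁` the left side is (a bound for)
`‖Φ_A‖²·(E(Φ_A) − E₀)/(N k_L²)` and the right side is `4c₂A₀²‖Φ_A‖²`. -/
theorem exists_window_ratio_le {ι : Type*} (s : Finset ι) (p u : ι → ℝ)
    (hp : ∀ i ∈ s, 0 ≤ p i) (hu : ∀ i ∈ s, 0 ≤ u i)
    {j₀ j₁ : ℝ → ℝ} (hj₀ : Continuous j₀) (hj₁ : Continuous j₁) (hj : j₁ 0 = 0)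
    {c₂ : ℝ} (hc₂ : 0 ≤ c₂)
    (hc : ∀ t₀ : ℝ, 0 < t₀ → ∫ t in t₀..2 * t₀, j₁ t ^ 2 ≤ c₂ * ∫ t in t₀..2 * t₀, j₀ t ^ 2)
    {A₀ : ℝ} (hA : 0 < A₀) :
    ∃ A ∈ Icc A₀ (2 * A₀),
      A ^ 2 * ∑ i ∈ s, p i * j₁ (A * u i) ^ 2 ≤ 4 * c₂ * A₀ ^ 2 * ∑ i ∈ s, p i * j₀ (A * u i) ^ 2 := by
  have hA2 : A₀ < 2 * A₀ := by linarith
  -- continuity of the integrands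
  have hcont₁ : Continuous fun A : ℝ => A ^ 2 * ∑ i ∈ s, p i * j₁ (A * u i) ^ 2 := by
    refine (continuous_pow 2).mul (continuous_finsetSum _ fun i _ => ?_)
    exact continuous_const.mul ((hj₁.comp (continuous_id.mul continuous_const)).pow 2)
  have hcont₀ : Continuous fun A : ℝ => ∑ i ∈ s, p i * j₀ (A * u i) ^ 2 := by
    refine continuous_finsetSum _ fun i _ => ?_
    exact continuous_const.mul ((hj₀.comp (continuous_id.mul continuous_const)).pow 2)
  refine exists_mem_Icc_le_of_integral_le hA2 hcont₁.continuousOn hcont₀.continuousOn ?_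
  -- compare the integrals termwise
  have hterm : ∀ i ∈ s, ∫ A in A₀..2 * A₀, A ^ 2 * (p i * j₁ (A * u i) ^ 2) ≤
      4 * c₂ * A₀ ^ 2 * ∫ A in A₀..2 * A₀, p i * j₀ (A * u i) ^ 2 := by
    intro i hi
    have hwin := window_scaling' hc₂ hj hc hA (hu i hi)
    have hci : IntervalIntegrable (fun A => A ^ 2 * (p i * j₁ (A * u i) ^ 2)) volume A₀ (2 * A₀) :=
      (((continuous_pow 2).mul (continuous_const.mul
        ((hj₁.comp (continuous_id.mul continuous_const)).pow 2))).intervalIntegrable _ _)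
    have hci' : IntervalIntegrable (fun A => (2 * A₀) ^ 2 * (p i * j₁ (A * u i) ^ 2)) volume A₀ (2 * A₀) :=
      ((continuous_const.mul (continuous_const.mul
        ((hj₁.comp (continuous_id.mul continuous_const)).pow 2))).intervalIntegrable _ _)
    have step1 : ∫ A in A₀..2 * A₀, A ^ 2 * (p i * j₁ (A * u i) ^ 2) ≤
        ∫ A in A₀..2 * A₀, (2 * A₀) ^ 2 * (p i * j₁ (A * u i) ^ 2) := by
      refine intervalIntegral.integral_mono_on hA2.le hci hci' fun A hA' => ?_
      have hA'2 : A ^ 2 ≤ (2 * A₀) ^ 2 := by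
        have : 0 ≤ A := by linarith [hA'.1]
        exact pow_le_pow_left₀ this hA'.2 2
      exact mul_le_mul_of_nonneg_right hA'2 (mul_nonneg (hp i hi) (sq_nonneg _))
    rw [intervalIntegral.integral_const_mul, intervalIntegral.integral_const_mul] at step1
    rw [intervalIntegral.integral_const_mul]
    have hp' := hp i hi
    calc (∫ A in A₀..2 * A₀, A ^ 2 * (p i * j₁ (A * u i) ^ 2))
        ≤ (2 * A₀) ^ 2 * (p i * ∫ A in A₀..2 * A₀, j₁ (A * u i) ^ 2) := step1
      _ ≤ (2 * A₀) ^ 2 * (p i * (c₂ * ∫ A in A₀..2 * A₀, j₀ (A * u i) ^ 2)) := by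
          exact mul_le_mul_of_nonneg_left (mul_le_mul_of_nonneg_left hwin hp') (sq_nonneg _)
      _ = 4 * c₂ * A₀ ^ 2 * (p i * ∫ A in A₀..2 * A₀, j₀ (A * u i) ^ 2) := by ring
  -- sum over atoms
  have hint₁ : ∀ i ∈ s, IntervalIntegrable (fun A => A ^ 2 * (p i * j₁ (A * u i) ^ 2)) volume A₀ (2 * A₀) :=
    fun i _ => (((continuous_pow 2).mul (continuous_const.mul
        ((hj₁.comp (continuous_id.mul continuous_const)).pow 2))).intervalIntegrable _ _)
  have hint₀ : ∀ i ∈ s, IntervalIntegrable (fun A => p i * j₀ (A * u i) ^ 2) volume A₀ (2 * A₀) :=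
    fun i _ => ((continuous_const.mul
        ((hj₀.comp (continuous_id.mul continuous_const)).pow 2)).intervalIntegrable _ _)
  calc ∫ A in A₀..2 * A₀, A ^ 2 * ∑ i ∈ s, p i * j₁ (A * u i) ^ 2
      = ∫ A in A₀..2 * A₀, ∑ i ∈ s, A ^ 2 * (p i * j₁ (A * u i) ^ 2) := by
        refine intervalIntegral.integral_congr fun A _ => ?_
        simp only [Finset.mul_sum]
    _ = ∑ i ∈ s, ∫ A in A₀..2 * A₀, A ^ 2 * (p i * j₁ (A * u i) ^ 2) :=
        intervalIntegral.integral_finsetSum hint₁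
    _ ≤ ∑ i ∈ s, 4 * c₂ * A₀ ^ 2 * ∫ A in A₀..2 * A₀, p i * j₀ (A * u i) ^ 2 :=
        Finset.sum_le_sum hterm
    _ = 4 * c₂ * A₀ ^ 2 * ∑ i ∈ s, ∫ A in A₀..2 * A₀, p i * j₀ (A * u i) ^ 2 := by
        rw [Finset.mul_sum]
    _ = 4 * c₂ * A₀ ^ 2 * ∫ A in A₀..2 * A₀, ∑ i ∈ s, p i * j₀ (A * u i) ^ 2 := by
        rw [intervalIntegral.integral_finsetSum hint₀]

/-! ## 6. The ground-state representation on a weighted graph -/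

/-- Discrete ground-state representation: for a symmetric hopping matrix `w`, a potential `U` and
an eigenvector `ψ` (`−Σ_y w_{xy}ψ_y + U_xψ_x = Eψ_x`), the quadratic form of `H − E` on the
multiplicatively deformed vector `Fψ` is `½ Σ_{x,y} w_{xy} ψ_x ψ_y (F_x − F_y)²`. -/
theorem discrete_groundState_repr {V : Type*} [Fintype V] (w : V → V → ℝ)
    (hw : ∀ x y, w x y = w y x) (U ψ F : V → ℝ) (E : ℝ)
    (hψ : ∀ x, -∑ y, w x y * ψ y + U x * ψ x = E * ψ x) :
    ∑ x, F x * ψ x * ((-∑ y, w x y * (F y * ψ y) + U x * (F x * ψ x)) - E * (F x * ψ x)) =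
      (1 / 2) * ∑ x, ∑ y, w x y * ψ x * ψ y * (F x - F y) ^ 2 := by
  -- pointwise: substitute the eigenvalue equation
  have key : ∀ x, F x * ψ x * ((-∑ y, w x y * (F y * ψ y) + U x * (F x * ψ x)) - E * (F x * ψ x)) =
      ∑ y, w x y * ψ x * ψ y * (F x * (F x - F y)) := by
    intro x
    have hE : E * (F x * ψ x) = F x * (-∑ y, w x y * ψ y + U x * ψ x) := by
      rw [hψ x]; ring
    rw [hE]
    have : (-∑ y, w x y * (F y * ψ y) + U x * (F x * ψ x)) - F x * (-∑ y, w x y * ψ y + U x * ψ x) =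
        ∑ y, w x y * ψ y * (F x - F y) := by
      have h1 : ∑ y, w x y * ψ y * (F x - F y) = F x * ∑ y, w x y * ψ y - ∑ y, w x y * (F y * ψ y) := by
        rw [Finset.mul_sum, ← Finset.sum_sub_distrib]
        refine Finset.sum_congr rfl fun y _ => by ring
      rw [h1]; ring
    rw [this, Finset.mul_sum]
    refine Finset.sum_congr rfl fun y _ => by ring
  simp_rw [key]
  -- symmetrise the double sum
  set a : V → V → ℝ := fun x y => w x y * ψ x * ψ y * (F x * (F x - F y)) with ha
  have hcomm : ∑ x, ∑ y, a x y = ∑ x, ∑ y, a y x := Finset.sum_comm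
  have hsum : ∑ x, ∑ y, a x y = (1 / 2) * ∑ x, ∑ y, (a x y + a y x) := by
    have : ∑ x, ∑ y, (a x y + a y x) = ∑ x, ∑ y, a x y + ∑ x, ∑ y, a y x := by
      rw [← Finset.sum_add_distrib]
      refine Finset.sum_congr rfl fun x _ => Finset.sum_add_distrib
    rw [this, ← hcomm]; ring
  change ∑ x, ∑ y, a x y = _
  rw [hsum]
  congr 1
  refine Finset.sum_congr rfl fun x _ => Finset.sum_congr rfl fun y _ => ?_
  simp only [ha]
  rw [hw y x]
  ring

/-- Consequence: with nonnegative hoppings and a nonnegative eigenvector the deformed form is `≥ 0`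
(the variational principle behind `E(FΨ₀) ≥ E₀`), and it is controlled by the "gradient" of `F` alone. -/
theorem discrete_groundState_form_nonneg {V : Type*} [Fintype V] (w : V → V → ℝ)
    (hw : ∀ x y, w x y = w y x) (hw0 : ∀ x y, 0 ≤ w x y) (U ψ F : V → ℝ) (hψ0 : ∀ x, 0 ≤ ψ x) (E : ℝ)
    (hψ : ∀ x, -∑ y, w x y * ψ y + U x * ψ x = E * ψ x) :
    0 ≤ ∑ x, F x * ψ x * ((-∑ y, w x y * (F y * ψ y) + U x * (F x * ψ x)) - E * (F x * ψ x)) := by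
  rw [discrete_groundState_repr w hw U ψ F E hψ]
  refine mul_nonneg (by norm_num) (Finset.sum_nonneg fun x _ => Finset.sum_nonneg fun y _ => ?_)
  have := hw0 x y; have := hψ0 x; have := hψ0 y
  positivity

end Summit.AtomisticToContinuum.BoseEinsteinCondensation.Theorems

end
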